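import Summits.QuantumFields.YangMills.Theorems.BalabanUVNodesN19TiltedPriceTwoSided
import Mathlib.Analysis.SpecialFunctions.Trigonometric.Chebyshev.Basic
import Mathlib.Analysis.SpecialFunctions.Trigonometric.Bounds

/-!
# YM-DAG node N19 (= NE7 proper) — THE INTERIOR PRICE FROM BELOW, module 1∕3: the grid-Chebyshev weights DETUNED — the
# `U_{M−1}` phase at an interior source is controllable

Cell `pub-ymgap`, HUMAN RULING D-0062 (Track A), R141 (C) wider-strategy seat `pub-ymgap-dag-n19-e` (strategy s3 = ALTERNATIVE CURRENCY), generation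
g16, module 1 of 3 (siblings: `…N19TiltedPriceInteriorBernstein` — the Bernstein-size derivative at a source; `…N19TiltedPriceInteriorTwoSided` — the
probability-law level, two-sided).  Route `Summits/QuantumFields/YangMills/Theses/BalabanUVNodes.lean` rev 23, cluster item K3⁶ «SpineGivenEndpointR13SepCoPR»
(stmt-QuantumFields-20509); filed `--supports` that item `--as helper` (it proves no registered stub).  COUNT-NEUTRAL: elementary, over Mathlib
(`Polynomial.Chebyshev.T_derivative_eq_U`, `U_real_cos`, `U_eval_neg`, `Int.negOnePow_even`, `Real.arccos`, `abs_cos_sub_cos_le` ∕ `abs_sin_sub_sin_le`,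
`cos_int_mul_pi`) and the seat's modules BY NAME — p509390 `…N19NoLinearPriceWitness` (the transported Chebyshev polynomial `P_M = T_M ∘ ((u−1)∕r)`:
`natDegree_chebAff`, `sum_abs_coeff_chebAff_le`, `pow_le_sum_abs_coeff_chebAff`, `sum_coeff_chebAff_eq_zero`, `abs_eval_chebAff_le_one`), p510514
`…N19NoLinearPrice` (`expsum_eq_eval`, `abs_expm1_ratio_le_one`), p530176 `…N19TiltedPriceTwoSided` (`sum_coeff_mul_mul_pow_eq`); NOT a discharge claim.

WHAT IT SAYS.  p528923 `…N19TiltedPrice` bounds the tilted-mean difference at an interior source `|s| < l₀` of two bounded observables with cgf's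
`ε`-close on `|u| ≤ l₀` by Bernstein's `≍ ε·n∕√(l₀² − s²)`, `n = log ε⁻¹∕log log ε⁻¹`, and records (its header, «NOT claimed») that a LOWER bound of
the same shape was not typed because the phase of `U_{M−1}` at the image of the source is not controlled for the grid-Chebyshev pair of p510514
(`w_j = (2∕Λ)[uʲ]P_M`, `r = r₀ := e^{l₀∕M} − 1`).  HERE the phase is controlled by DETUNING `r`.  §2 ★ `exists_expsum_witness_detuned`: every `r ≥ r₀` keeps
mass zero (odd `M`), the window inside `[−1, 1]` and the lower `ε`-bracket, and `r ≤ 2r₀` keeps the upper one — weights with `Σ w_j = 0`, `Σ |w_j| = 2`,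
`2(1 + 4M∕l₀)^{−M} ≤ ε ≤ 4(l₀e^{l₀}∕M)^M`, `|Σ_j w_j e^{tj∕M}| ≤ ε` on `|t| ≤ l₀`, and AT EVERY SOURCE the `t`-derivative IDENTITY
`Σ_j w_j (j∕M) e^{sj∕M} = ε·e^{s∕M}·U_{M−1}((e^{s∕M} − 1)∕r)∕r` (§1 `derivative_chebAff_eval`: `P_M′(u) = (M∕r)·U_{M−1}((u−1)∕r)`).  §3 ★ `exists_detune_U`:
for odd `M ≥ 3` and `0 < y₀ < 1` with `π∕M ≤ y₀∕2` and `π∕M ≤ √(1 − y₀²)` there is `x ∈ [y₀∕2, y₀]` with `|U_{M−1}(±x)| ≥ 1∕(2√(1 − y₀²))` — write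
`y₀ = cos θ₀`; the Chebyshev extremal angle `Mθ* ∈ π∕2 + πℤ` in `[Mθ₀, Mθ₀ + π)` (§1 `exists_pi_div_two_add_int_mul_pi_mem_Ico`) gives `x = cos θ*` with
`|U_{M−1}(cos θ*)|·sin θ* = |sin(Mθ*)| = 1` (§1 `abs_eval_U_mul_sin_eq_one`, Mathlib `U_real_cos`), `x ≥ y₀ − π∕M ≥ y₀∕2`, `sin θ* ≤ sin θ₀ + π∕M ≤ 2 sin θ₀`;
`U_{M−1}` is even for odd `M`.  Module 2 detunes `r` so that the image `(e^{s∕M} − 1)∕r` of the source is this `±x`.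

KERNEL-CHECKED (0 `def`, 0 `sorry`): §1 [folklore] `derivative_chebAff_eval`, `exists_pi_div_two_add_int_mul_pi_mem_Ico`, `abs_sin_pi_div_two_add_int_mul_pi`,
`abs_eval_U_mul_sin_eq_one`, `abs_exp_sub_one_le_exp_abs_sub_one`, `abs_mul_exp_neg_abs_le_abs_exp_sub_one` (`|σ|e^{−|σ|} ≤ |e^σ − 1| ≤ e^{|σ|} − 1`, used in
module 2) · §2 ★ `exists_expsum_witness_detuned` · §3 ★ `exists_detune_U`.  NOT claimed: optimal constants.

HONEST FRAMING (binding).  Elementary; NO consumer in the DAG today; value = the engine of the optimality certificate for p528923's interior price (modules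
2–3).  Nothing of [Balaban1987RG1]–[Balaban1989LargeFieldII] or [King1986] is asserted, quoted or instantiated; NE7 ∕ NE7b ∕ NE7c NOT PRINTED, NOT proved;
N19 NOT discharged; Track A count unmoved (typed 28∕28 · discharged 5∕27 · A 5∕28).  One finite `T⁴` programme at fixed `ε`; nothing continuum ∕ `ℝ⁴` ∕ OS ∕
mass-gap ∕ Clay.  THEOREMS ONLY; standard axioms; no cite tags.
-/

set_option autoImplicit false

noncomputable section

open Polynomial Real Finset

namespace Summit.QuantumFields.YangMills.Theorems.BalabanUVNodesN19TiltedPriceInteriorWitness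

open Summit.QuantumFields.YangMills.Theorems.BalabanUVNodesN19NoLinearPriceWitness
open Summit.QuantumFields.YangMills.Theorems.BalabanUVNodesN19NoLinearPrice (expsum_eq_eval abs_expm1_ratio_le_one)
open Summit.QuantumFields.YangMills.Theorems.BalabanUVNodesN19TiltedPriceTwoSided (sum_coeff_mul_mul_pow_eq)

/-! ## §1 The transported Chebyshev derivative at every point, extremal angles, two `exp` inequalities [folklore] -/

/-- THE TRANSPORTED CHEBYSHEV DERIVATIVE: `P_M′(u) = (M∕r)·U_{M−1}((u − 1)∕r)` (`T_M′ = M·U_{M−1}`). [folklore] -/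
theorem derivative_chebAff_eval (r : ℝ) (M : ℕ) (u : ℝ) :
    (derivative ((Chebyshev.T ℝ M).comp (C r⁻¹ * (X - C 1)))).eval u =
      (M : ℝ) * (Chebyshev.U ℝ ((M : ℤ) - 1)).eval (r⁻¹ * (u - 1)) * r⁻¹ := by
  have hdq : derivative (C r⁻¹ * (X - C 1) : ℝ[X]) = C r⁻¹ := by
    rw [derivative_C_mul, derivative_sub, derivative_X, derivative_C, sub_zero, mul_one]
  rw [derivative_comp, hdq, eval_mul, eval_C, eval_comp, Chebyshev.T_derivative_eq_U]
  simp only [eval_mul, eval_C, eval_sub, eval_X, eval_natCast, Int.cast_natCast]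
  ring

/-- Every half-open interval of length `π` holds a point of `π∕2 + πℤ`. [folklore] -/
theorem exists_pi_div_two_add_int_mul_pi_mem_Ico (a : ℝ) :
    ∃ k : ℤ, a ≤ π / 2 + k * π ∧ π / 2 + k * π < a + π := by
  refine ⟨⌈(a - π / 2) / π⌉, ?_, ?_⟩
  · have h := (div_le_iff₀ Real.pi_pos).1 (Int.le_ceil ((a - π / 2) / π))
    linarith
  · have h1 : ((⌈(a - π / 2) / π⌉ : ℤ) : ℝ) - 1 < (a - π / 2) / π := by
      linarith [Int.ceil_lt_add_one ((a - π / 2) / π)]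
    have h2 := (lt_div_iff₀ Real.pi_pos).1 h1
    linarith

/-- `|sin(π∕2 + kπ)| = 1`. [folklore] -/
theorem abs_sin_pi_div_two_add_int_mul_pi (k : ℤ) : |Real.sin (π / 2 + k * π)| = 1 := by
  rw [add_comm, Real.sin_add_pi_div_two, Real.cos_int_mul_pi, abs_zpow, abs_neg, abs_one, one_zpow]

/-- AT A CHEBYSHEV EXTREMAL ANGLE `Mθ ∈ π∕2 + πℤ`: `|U_{M−1}(cos θ)|·sin θ = |sin(Mθ)| = 1` (Mathlib `U_real_cos`). [folklore] -/
theorem abs_eval_U_mul_sin_eq_one {M : ℕ} {θ : ℝ} (k : ℤ) (hθ : (M : ℝ) * θ = π / 2 + k * π)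
    (hsin : 0 ≤ Real.sin θ) :
    |(Chebyshev.U ℝ ((M : ℤ) - 1)).eval (Real.cos θ)| * Real.sin θ = 1 := by
  have h := Chebyshev.U_real_cos θ ((M : ℤ) - 1)
  have h' : (Chebyshev.U ℝ ((M : ℤ) - 1)).eval (Real.cos θ) * Real.sin θ = Real.sin (π / 2 + k * π) := by
    rw [h, ← hθ]
    push_cast
    ring_nf
  rw [← abs_of_nonneg hsin, ← abs_mul, h', abs_sin_pi_div_two_add_int_mul_pi]

/-- `|e^σ − 1| ≤ e^{|σ|} − 1`. [folklore] -/
theorem abs_exp_sub_one_le_exp_abs_sub_one (σ : ℝ) : |Real.exp σ - 1| ≤ Real.exp |σ| - 1 := by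
  rcases le_or_gt 0 σ with h | h
  · rw [abs_of_nonneg h, abs_of_nonneg (sub_nonneg.2 (Real.one_le_exp h))]
  · have h1 := Real.add_one_le_exp σ
    have h2 := Real.add_one_le_exp (-σ)
    have h3 : Real.exp σ < 1 := Real.exp_lt_one_iff.2 h
    rw [abs_of_neg h, abs_of_neg (by linarith)]
    linarith

/-- `|σ|·e^{−|σ|} ≤ |e^σ − 1|`. [folklore] -/
theorem abs_mul_exp_neg_abs_le_abs_exp_sub_one (σ : ℝ) : |σ| * Real.exp (-|σ|) ≤ |Real.exp σ - 1| := by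
  rcases le_or_gt 0 σ with h | h
  · rw [abs_of_nonneg h, abs_of_nonneg (sub_nonneg.2 (Real.one_le_exp h))]
    have h1 : Real.exp (-σ) ≤ 1 := Real.exp_le_one_iff.2 (by linarith)
    have h2 := Real.add_one_le_exp σ
    nlinarith [mul_le_mul_of_nonneg_left h1 h]
  · have h3 : Real.exp σ < 1 := Real.exp_lt_one_iff.2 h
    rw [abs_of_neg h, neg_neg, abs_of_neg (by linarith)]
    have h2 := Real.add_one_le_exp (-σ)
    have hprod : Real.exp σ * Real.exp (-σ) = 1 := by rw [← Real.exp_add, add_neg_cancel, Real.exp_zero]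
    nlinarith [Real.exp_pos σ, mul_le_mul_of_nonneg_left h2 (Real.exp_pos σ).le]

/-! ## §2 The grid-Chebyshev weights with a DETUNED affine parameter `r ∈ [r₀, 2r₀]` -/

/-- **THE DETUNED WITNESS.**  For `0 < l₀`, odd `M` and every `r` with `r₀ ≤ r ≤ 2r₀`, `r₀ = e^{l₀∕M} − 1`: weights `w_0, …, w_M`
(`w_j = (2∕Λ)[uʲ]P_M`, `P_M = T_M∘((u−1)∕r)`, `Λ = Σ|[uʲ]P_M|`, `ε = 2∕Λ`) with `Σ w_j = 0`, `Σ |w_j| = 2`, `2(1 + 4M∕l₀)^{−M} ≤ ε ≤ 4(l₀e^{l₀}∕M)^M`,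
`|Σ_j w_j e^{tj∕M}| ≤ ε` on `|t| ≤ l₀`, and AT EVERY SOURCE `s` the `t`-derivative identity `Σ_j w_j (j∕M) e^{sj∕M} = ε·e^{s∕M}·U_{M−1}((e^{s∕M}−1)∕r)∕r`
(§1 `derivative_chebAff_eval` + p530176's `sum_coeff_mul_mul_pow_eq`).  At `r = r₀` these are p510514's weights. [folklore] -/
theorem exists_expsum_witness_detuned {l₀ : ℝ} (hl₀ : 0 < l₀) {M : ℕ} (hM : Odd M) {r : ℝ}
    (hr₁ : Real.exp (l₀ / M) - 1 ≤ r) (hr₂ : r ≤ 2 * (Real.exp (l₀ / M) - 1)) :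
    ∃ (w : ℕ → ℝ) (ε : ℝ), 0 < ε ∧
      ∑ j ∈ range (M + 1), w j = 0 ∧ ∑ j ∈ range (M + 1), |w j| = 2 ∧
      2 / (1 + 4 * M / l₀) ^ M ≤ ε ∧ ε ≤ 4 * (l₀ * Real.exp l₀ / M) ^ M ∧
      (∀ t : ℝ, |t| ≤ l₀ → |∑ j ∈ range (M + 1), w j * Real.exp (t * j / M)| ≤ ε) ∧
      ∀ s : ℝ, ∑ j ∈ range (M + 1), w j * (j / M) * Real.exp (s * j / M) =
        ε * (Real.exp (s / M) * (Chebyshev.U ℝ ((M : ℤ) - 1)).eval (r⁻¹ * (Real.exp (s / M) - 1)) / r) := by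
  have hM0 : 0 < M := hM.pos
  have hMr : (0 : ℝ) < M := Nat.cast_pos.mpr hM0
  have hM1 : (1 : ℝ) ≤ M := by exact_mod_cast hM0
  have ha0 : 0 < l₀ / M := div_pos hl₀ hMr
  set r₀ : ℝ := Real.exp (l₀ / M) - 1 with hr₀_def
  have hr₀a : l₀ / M ≤ r₀ := by rw [hr₀_def]; linarith [Real.add_one_le_exp (l₀ / M)]
  have hr₀0 : 0 < r₀ := ha0.trans_le hr₀a
  have hr0 : 0 < r := hr₀0.trans_le hr₁
  have hal : l₀ / M ≤ l₀ := div_le_self hl₀.le hM1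
  have hr₀_mul : r₀ ≤ l₀ / M * Real.exp (l₀ / M) := Literature.Analysis.ODE.exp_sub_one_le_mul_exp _
  have hr₀_le : r₀ ≤ l₀ * Real.exp l₀ / M := by
    calc r₀ ≤ l₀ / M * Real.exp (l₀ / M) := hr₀_mul
      _ ≤ l₀ / M * Real.exp l₀ := mul_le_mul_of_nonneg_left (Real.exp_le_exp.mpr hal) ha0.le
      _ = l₀ * Real.exp l₀ / M := by ring
  set P : ℝ[X] := (Chebyshev.T ℝ M).comp (C r⁻¹ * (X - C 1)) with hP
  have hPdeg : P.natDegree < M + 1 := by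
    rw [hP, natDegree_chebAff hr0.ne']
    exact Nat.lt_succ_self M
  set Λ : ℝ := ∑ j ∈ range (M + 1), |P.coeff j| with hΛ
  have hΛlo : 2 ^ (M - 1) * r⁻¹ ^ M ≤ Λ := pow_le_sum_abs_coeff_chebAff hr0 M
  have hΛhi : Λ ≤ (1 + 4 / r) ^ M := sum_abs_coeff_chebAff_le hr0 M M le_rfl
  have hlead : 0 < (2 : ℝ) ^ (M - 1) * r⁻¹ ^ M := by positivity
  have hΛ0 : 0 < Λ := lt_of_lt_of_le hlead hΛlo
  have hc0 : 0 < 2 / Λ := by positivity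
  have hsum : ∀ g : ℕ → ℝ, ∑ j ∈ range (M + 1), 2 / Λ * P.coeff j * g j =
      2 / Λ * ∑ j ∈ range (M + 1), P.coeff j * g j := fun g => by
    rw [mul_sum]; exact sum_congr rfl fun j _ => mul_assoc _ _ _
  refine ⟨fun j => 2 / Λ * P.coeff j, 2 / Λ, hc0, ?_, ?_, ?_, ?_, ?_, ?_⟩
  · -- equal mass (odd `M`, any `r`)
    rw [← mul_sum, hP, sum_coeff_chebAff_eq_zero hr0.ne' hM, mul_zero]
  · -- total variation `2`
    have : ∀ j, |2 / Λ * P.coeff j| = 2 / Λ * |P.coeff j| := fun j => by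
      rw [abs_mul, abs_of_pos hc0]
    simp_rw [this]
    rw [← mul_sum, ← hΛ, div_mul_cancel₀ _ hΛ0.ne']
  · -- `ε` from below: `Λ ≤ (1 + 4/r)^M ≤ (1 + 4/r₀)^M ≤ (1 + 4M/l₀)^M`
    rw [div_le_div_iff_of_pos_left two_pos (by positivity) hΛ0]
    refine hΛhi.trans (pow_le_pow_left₀ (by positivity) ?_ M)
    have h4 : 4 / r ≤ 4 * M / l₀ := by
      rw [mul_div_assoc, div_eq_mul_inv 4 r]
      refine mul_le_mul_of_nonneg_left ?_ (by norm_num)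
      calc r⁻¹ ≤ r₀⁻¹ := inv_anti₀ hr₀0 hr₁
        _ ≤ (l₀ / M)⁻¹ := by rw [inv_le_inv₀ hr₀0 ha0]; exact hr₀a
        _ = M / l₀ := by rw [inv_div]
    linarith
  · -- `ε` from above: `Λ ≥ 2^{M−1} r^{−M}`, `r/2 ≤ r₀ ≤ l₀e^{l₀}/M`
    calc 2 / Λ ≤ 2 / (2 ^ (M - 1) * r⁻¹ ^ M) := div_le_div_of_nonneg_left zero_le_two hlead hΛlo
      _ = 4 * (r / 2) ^ M := by
          obtain ⟨k, rfl⟩ := Nat.exists_eq_add_of_le' hM0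
          rw [Nat.add_sub_cancel, div_pow, inv_pow, pow_succ (2 : ℝ) k]
          field_simp
          ring
      _ ≤ 4 * (l₀ * Real.exp l₀ / M) ^ M := by
          gcongr 4 * ?_ ^ M
          linarith
  · -- the window bound: `|r⁻¹(e^{t/M} − 1)| ≤ |r₀⁻¹(e^{t/M} − 1)| ≤ 1`
    intro t ht
    rw [hsum, expsum_eq_eval P hPdeg M t, abs_mul, abs_of_pos hc0]
    refine mul_le_of_le_one_right hc0.le ?_
    rw [hP]
    refine abs_eval_chebAff_le_one r M ?_
    have h1 : |r₀⁻¹ * (Real.exp (t / M) - 1)| ≤ 1 := by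
      rw [hr₀_def]; exact abs_expm1_ratio_le_one hl₀ hM0 ht
    calc |r⁻¹ * (Real.exp (t / M) - 1)| = r⁻¹ * |Real.exp (t / M) - 1| := by
          rw [abs_mul, abs_of_pos (inv_pos.2 hr0)]
      _ ≤ r₀⁻¹ * |Real.exp (t / M) - 1| := mul_le_mul_of_nonneg_right (inv_anti₀ hr₀0 hr₁) (abs_nonneg _)
      _ = |r₀⁻¹ * (Real.exp (t / M) - 1)| := by rw [abs_mul, abs_of_pos (inv_pos.2 hr₀0)]
      _ ≤ 1 := h1
  · -- the derivative identity at every source: `(ε/M)·u·P′(u)`, `u = e^{s/M}`, `P′(u) = (M/r)U_{M−1}((u−1)/r)`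
    intro s
    have hmom : ∑ j ∈ range (M + 1), 2 / Λ * P.coeff j * ((j : ℝ) / M) * Real.exp (s * j / M) =
        2 / Λ / M * ∑ j ∈ range (M + 1), P.coeff j * j * Real.exp (s / M) ^ j := by
      rw [mul_sum]
      refine sum_congr rfl fun j _ => ?_
      rw [← Real.exp_nat_mul, show (j : ℝ) * (s / M) = s * j / M by ring]
      field_simp
    rw [hmom, sum_coeff_mul_mul_pow_eq P hPdeg, hP, derivative_chebAff_eval r M]
    field_simp

/-! ## §3 Phase control: detuning to a Chebyshev extremal angle -/

/-- **★ THE `U_{M−1}` PHASE IS CONTROLLABLE.**  For odd `M ≥ 3` and `0 < y₀ < 1` with `π∕M ≤ y₀∕2` and `π∕M ≤ √(1 − y₀²)` there is `x ∈ [y₀∕2, y₀]`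
with `|U_{M−1}(x)| ≥ 1∕(2√(1 − y₀²))` and `|U_{M−1}(−x)| ≥ 1∕(2√(1 − y₀²))`: `y₀ = cos θ₀`, `θ₀ ∈ (0, π∕2)`; the extremal angle `Mθ* ∈ π∕2 + πℤ` in
`[Mθ₀, Mθ₀ + π)`; `x = cos θ*` has `|U_{M−1}(x)| = 1∕sin θ*`, `x ≥ y₀ − π∕M ≥ y₀∕2`, `sin θ* ≤ sin θ₀ + π∕M ≤ 2 sin θ₀ = 2√(1 − y₀²)`; `U_{M−1}` is even.
[folklore] -/
theorem exists_detune_U {M : ℕ} (hM : Odd M) (hM3 : 3 ≤ M) {y₀ : ℝ} (hy0 : 0 < y₀) (hy1 : y₀ < 1)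
    (hπ1 : π / M ≤ y₀ / 2) (hπ2 : π / M ≤ Real.sqrt (1 - y₀ ^ 2)) :
    ∃ x : ℝ, y₀ / 2 ≤ x ∧ x ≤ y₀ ∧
      1 / (2 * Real.sqrt (1 - y₀ ^ 2)) ≤ |(Chebyshev.U ℝ ((M : ℤ) - 1)).eval x| ∧
      1 / (2 * Real.sqrt (1 - y₀ ^ 2)) ≤ |(Chebyshev.U ℝ ((M : ℤ) - 1)).eval (-x)| := by
  have hM0 : 0 < M := hM.pos
  have hMr : (0 : ℝ) < M := Nat.cast_pos.mpr hM0
  have hM3r : (3 : ℝ) ≤ M := by exact_mod_cast hM3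
  have hπM : 0 < π / M := div_pos Real.pi_pos hMr
  -- the angle of `y₀`
  set θ₀ : ℝ := Real.arccos y₀ with hθ₀
  have hθ₀0 : 0 ≤ θ₀ := Real.arccos_nonneg y₀
  have hθ₀2 : θ₀ ≤ π / 2 := Real.arccos_le_pi_div_two.2 hy0.le
  have hcos₀ : Real.cos θ₀ = y₀ := Real.cos_arccos (by linarith) hy1.le
  have hsin₀ : Real.sin θ₀ = Real.sqrt (1 - y₀ ^ 2) := Real.sin_arccos y₀
  have hsq0 : 0 < 1 - y₀ ^ 2 := by nlinarith
  have hsin₀pos : 0 < Real.sin θ₀ := by rw [hsin₀]; exact Real.sqrt_pos.2 hsq0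
  -- the extremal angle `θ*` with `Mθ* = π/2 + kπ ∈ [Mθ₀, Mθ₀ + π)`
  obtain ⟨k, hk1, hk2⟩ := exists_pi_div_two_add_int_mul_pi_mem_Ico (M * θ₀)
  set θ : ℝ := (π / 2 + k * π) / M with hθdef
  have hMθ : (M : ℝ) * θ = π / 2 + k * π := by rw [hθdef]; field_simp
  have hθlo : θ₀ ≤ θ := by
    rw [hθdef, le_div_iff₀ hMr, mul_comm]; exact hk1
  have hθhi : θ < θ₀ + π / M := by
    rw [hθdef, div_lt_iff₀ hMr, add_mul, div_mul_cancel₀ _ hMr.ne', mul_comm θ₀]; exact hk2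
  have hθpos : 0 < θ := by
    have hk0 : (0 : ℤ) ≤ k := by
      by_contra hneg
      have hk' : k ≤ -1 := by omega
      have hk'' : (k : ℝ) ≤ -1 := by exact_mod_cast hk'
      have : (M : ℝ) * θ₀ < 0 := by nlinarith [Real.pi_pos]
      exact absurd this (not_lt.2 (mul_nonneg hMr.le hθ₀0))
    have hk0r : (0 : ℝ) ≤ k := by exact_mod_cast hk0
    rw [hθdef]; positivity
  have hθpi : θ < π := by
    have h1 : π / M ≤ π / 3 := div_le_div_of_nonneg_left Real.pi_pos.le (by norm_num) hM3r
    linarith [Real.pi_pos]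
  have hsinθ : 0 < Real.sin θ := Real.sin_pos_of_pos_of_lt_pi hθpos hθpi
  -- `x = cos θ*`
  refine ⟨Real.cos θ, ?_, ?_, ?_⟩
  · -- `x ≥ y₀ − π/M ≥ y₀/2`
    have h := Real.abs_cos_sub_cos_le θ θ₀
    rw [hcos₀, abs_of_nonneg (sub_nonneg.2 hθlo)] at h
    have h2 : y₀ - Real.cos θ ≤ θ - θ₀ := by
      rw [abs_sub_comm] at h; exact (le_abs_self _).trans h
    linarith
  · -- `x ≤ y₀` (cos antitone on `[0, π]`)
    rw [← hcos₀]
    exact Real.cos_le_cos_of_nonneg_of_le_pi hθ₀0 hθpi.le hθlo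
  · -- `|U_{M−1}(±x)| = 1/sin θ* ≥ 1/(2 sin θ₀)`
    have hU : |(Chebyshev.U ℝ ((M : ℤ) - 1)).eval (Real.cos θ)| * Real.sin θ = 1 :=
      abs_eval_U_mul_sin_eq_one k hMθ hsinθ.le
    have hUeq : |(Chebyshev.U ℝ ((M : ℤ) - 1)).eval (Real.cos θ)| = 1 / Real.sin θ := by
      rw [eq_div_iff hsinθ.ne']; exact hU
    have hsinle : Real.sin θ ≤ 2 * Real.sqrt (1 - y₀ ^ 2) := by
      have h := Real.abs_sin_sub_sin_le θ θ₀
      rw [abs_of_nonneg (sub_nonneg.2 hθlo)] at h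
      have h' : Real.sin θ - Real.sin θ₀ ≤ θ - θ₀ := (le_abs_self _).trans h
      rw [hsin₀] at h'
      linarith
    have hmain : 1 / (2 * Real.sqrt (1 - y₀ ^ 2)) ≤ |(Chebyshev.U ℝ ((M : ℤ) - 1)).eval (Real.cos θ)| := by
      rw [hUeq]
      exact one_div_le_one_div_of_le hsinθ hsinle
    refine ⟨hmain, ?_⟩
    -- evenness of `U_{M−1}` for odd `M`
    have hidx : ((M : ℤ) - 1) = ((M - 1 : ℕ) : ℤ) := by omega
    have hev : Even (((M - 1 : ℕ) : ℤ)) := by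
      obtain ⟨m, hm⟩ := hM
      exact ⟨m, by omega⟩
    rw [hidx, Chebyshev.U_eval_neg, Int.negOnePow_even _ hev]
    simpa [← hidx] using hmain

end Summit.QuantumFields.YangMills.Theorems.BalabanUVNodesN19TiltedPriceInteriorWitness

end
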